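import Literature.Barriers.PneNP.RelativizationSparse
import Literature.Computability.Complexity.BakerGillSolovay
import Literature.Computability.Complexity.AdaptiveQueries
import Literature.Computability.Complexity.OracleSimulateFP
import Literature.Computability.Complexity.PlumbingBricks
import HarnessLib

/-!
# Barrier catalogue `PneNP`: relativization over tally oracles — discharge of Long–Selman's
tally theorem `longSelman1986_tally` (`P = NP ↔ ∀ tally T, P^T = NP^T`)

Sibling proof file of `Literature/Barriers/PneNP/RelativizationSparse.lean` (D-0014), next to
`RelativizationSparseProofs.lean` (which discharges `bgs_ne_sparse`, `RelativizationNarrow` and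
Meyer's theorem). It discharges the two remaining named facts of that file:

* `Literature.Barriers.PneNP.longSelman1986_tally_mp_holds : longSelman1986_tally_mp` —
  `P = NP → ∀ tally T, P^T = NP^T` (the direction printed as "the main proof direction");
* `Literature.Barriers.PneNP.longSelman1986_tally_holds : longSelman1986_tally` —
  `P = NP ↔ ∀ tally T, P^T = NP^T` (with the tree theorem `P_eq_NP_of_cRelativizes_tally` for `←`,
  through `longSelman1986_tally_of_mp`),

and records the hypothesis-free forms of the two corollaries stated there under
`(h : longSelman1986_tally)` (`tally_not_cRelativizes_P_eq_NP_iff`,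
`tally_cRelativizes_P_eq_NP_iff_not_pneNP`).

## The statement and its sources

Long–Selman (J. ACM 33 (1986), abstract): "we prove that P = NP if and only if for every tally
language T, P(T) = NP(T)". The primary text is not held (acquisition request acq-00401); the
statement is quoted verbatim by Hemachandra–Rubinstein (TCS 92 (1992), Lemma 2.3, p. 313) and by
Schöning, *Complexity and Structure* (LNCS 211, 1986), §6.1, Corollary 6.4 "(Long and Selman) P = NP
if and only if for every tally set T, P(T) = NP(T)", read with `lit galaxy read`. Schöning derives
it from Book–Long–Selman's positive relativization `P = NP ↔ ∀ A, P(A) = NP_b(A)` (his Thm. 6.3: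
under `P = NP` the polynomially many configurations of the query-bounded machine reachable with the
TRUE oracle answers are explored deterministically, asking the oracle each query as it arises),
remarking that a nondeterministic machine querying a tally oracle asks only polynomially many
distinct strings. The proof formalised here is the direct form of that argument for tally oracles
in the tree's certificate model `NP^T = ∃ᵖ·P^T` (`Oracle.lean`): a `P^T` machine first READS THE
TABLE `t = [0⁰ ∈ T] [0¹ ∈ T] ⋯ [0^{m-1} ∈ T]` of the tally oracle up to the query bound `m`, after
which "some certificate `y` makes the `P^T` verifier accept `⟨x, y⟩`" is an unrelativized `NP`
predicate of `⟨x, t⟩` (the verifier is re-run with its oracle replaced by table look-ups), hence a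
`P` predicate when `P = NP`.

## The construction (transcript model of `Oracle.lean`; no Turing machine is programmed)

Let `T` be tally, `L ∈ NP^T`: `x ∈ L ↔ ∃ y, |y| ≤ p |x| ∧ ⟨x, y⟩ ∈ L'` with `L' ∈ P^T` decided by the
oracle algorithm `M` within `q` rounds with queries of length `≤ q`.

1. `LongSelman.tabLang t` — the TABLE ORACLE of a bit string `t`: `u ∈ tabLang t` iff `u ∈ 0*` and
   bit `|u|` of `t` is `1`; for `t = LongSelman.table T m` (bit `i` = `[0ⁱ ∈ T]`) it agrees with `T`
   on all strings of length `< m` (`mem_tabLang_table_iff`, tallyness of `T`), so `M` run against it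
   on `⟨x, y⟩` is `M` run against `T` whenever `m` exceeds the query bound (locality of runs,
   `Literature.Computability.QuantumComplexity.run_congr`).
2. `LongSelman.lookupLang` — the look-up language `{⟨⟨⟨x, t⟩, y⟩, u⟩ | u ∈ tabLang t}`, in `P` by the
   string-function algebra of the tree (`Plumb.dropFn`, `Kannan.zerosFn`, `PRelSigma.HeadIs`,
   projections; `lookupLang_mem_P`), so its oracle `Oracle.ofLanguage lookupLang` is an `FP` answer rule
   (`indicatorFn_mem_FP`).
3. `LongSelman.simL M q` — the verification language `{⟨⟨x, t⟩, y⟩ | M^{tabLang t} accepts ⟨x, y⟩}`,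
   in `P` (`simL_mem_P`) as the preimage of `HeadIs 1` under the emulation `OracleAlg.simFn` of
   `OracleSimulateFP.lean` (run `M` on `⟨x, y⟩`, answering each query `u` by the rule applied to
   `⟨input, u⟩`; `FP^{FP} ⊆ FP`), with its semantics `mem_simL_iff` from `OracleAlg.simFn_eq_of_run`.
4. `NPRel_subset_PRel_of_isTally` — with the explicit witness-length test `|y| ≤ p |x|` (`LenLe`)
   the language `L₂ = simL ∩ {|y| ≤ p |x|}` is in `P`, its projection
   `L₁ = {z | ∃ y, |y| ≤ p |z| ∧ ⟨z, y⟩ ∈ L₂}` is in `NP = P`, and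
   `L = adLang (0^{|answers|}) m L₁ T` is the bounded adaptive (here: truth-table) reduction of
   `AdaptiveQueries.lean` — ask `0⁰, 0¹, …, 0^{m(|x|)-1}` (`adBits_eq_table`), then decide
   `⟨x, table⟩ ∈ L₁` — which lands in `P^T` (`AdQuery.adLang_mem_PRel`); `m = q ∘ (2X + 2 + p) + 1`
   exceeds the length of every query of `M` on `⟨x, y⟩`, `|y| ≤ p |x|`.

`P^T ⊆ NP^T` is the tree theorem `PRel_subset_NPRel_holds` (`BakerGillSolovay.lean`).

## References

* T. J. Long, A. L. Selman, *Relativizing complexity classes with sparse oracles*, J. ACM 33 (1986)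
  618–627 [LongSelman1986] — abstract (statement); not held (acq-00401).
* U. Schöning, *Complexity and Structure*, LNCS 211, Springer 1986 [Schoning1986], §6.1,
  Thm. 6.3 (Book–Long–Selman) and Cor. 6.4 (Long–Selman) with their proofs (read via
  `lit galaxy read panama:514322333696005`).
* L. Hemachandra, R. Rubinstein, *Separating complexity classes with tally oracles*, TCS 92 (1992)
  309–318 [HemachandraRubinstein1992], Lemma 2.3 (p. 313).
* S. Arora, B. Barak, *Computational Complexity: A Modern Approach*, CUP 2009 [AroraBarak2009],
  §3.4 (oracle machines; a run is determined by the answers to its queries), Def. 2.1 (certificates).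
-/

namespace Literature.Barriers.PneNP

open _root_.Computability Literature.Computability.Complexity Literature.Computability.Complexity.Nondeterministic
  Literature.Computability.Complexity.Classes Polynomial Brick

namespace LongSelman

/-! ### The table oracle of a tally language -/

/-- **The table language of a bit string `t`**: `u ∈ tabLang t` iff `u ∈ 0*` and bit number `|u|`
of `t` is `1` (so `tabLang t ⊆ {0ⁱ | i < |t|}`) — the finite piece of a tally oracle that a `P^T`
machine reads into its memory (a proof device of this file). [folklore] -/
def tabLang (t : List Bool) : Language Bool :=
  {u | u = List.replicate u.length false ∧ (t.drop u.length).head? = some true}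

/-- **The table of a language `T` below length `m`**: bit `i` is `[0ⁱ ∈ T]`, `i < m` (a proof
device of this file). [folklore] -/
noncomputable def table (T : Language Bool) (m : ℕ) : List Bool :=
  (List.range m).map fun i => T.boolIndicator (List.replicate i false)

/-- The table below `m` has `m` bits. [folklore] -/
@[simp] theorem length_table (T : Language Bool) (m : ℕ) : (table T m).length = m := by
  simp [table]

/-- One more bit of the table. [folklore] -/
theorem table_succ (T : Language Bool) (m : ℕ) :
    table T (m + 1) = table T m ++ [T.boolIndicator (List.replicate m false)] := by
  simp [table, List.range_succ]

/-- Bit `i < m` of the table is `[0ⁱ ∈ T]`. [folklore] -/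
theorem head?_drop_table (T : Language Bool) {m i : ℕ} (hi : i < m) :
    ((table T m).drop i).head? = some (T.boolIndicator (List.replicate i false)) := by
  rw [List.head?_drop, table, List.getElem?_map, List.getElem?_range hi]
  rfl

/-- **The table oracle agrees with the tally oracle below the table length**: for tally `T` and
`|u| < m`, `u ∈ tabLang (table T m) ↔ u ∈ T` (a member of a tally language is `0^{|u|}`; Schöning,
proof of Cor. 6.4: a machine querying a tally oracle asks only the strings `0ⁱ`). [folklore] -/
theorem mem_tabLang_table_iff {T : Language Bool} (hT : IsTally T) {m : ℕ} {u : List Bool}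
    (hu : u.length < m) : u ∈ tabLang (table T m) ↔ u ∈ T := by
  change u = List.replicate u.length false ∧ ((table T m).drop u.length).head? = some true ↔ u ∈ T
  rw [head?_drop_table T hu, Option.some.injEq]
  constructor
  · rintro ⟨hrep, hind⟩
    rw [hrep]
    exact (Set.mem_iff_boolIndicator _ _).2 hind
  · intro huT
    have hrep : u = List.replicate u.length false := List.eq_replicate_iff.2 ⟨rfl, hT u huT⟩
    refine ⟨hrep, ?_⟩
    rw [← hrep]
    exact (Set.mem_iff_boolIndicator _ _).1 huT

/-- The table oracle answers every query of length `< m` as the tally oracle does. [folklore] -/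
theorem ofLanguage_tabLang_table {T : Language Bool} (hT : IsTally T) {m : ℕ} {u : List Bool}
    (hu : u.length < m) :
    Oracle.ofLanguage (tabLang (table T m)) u = Oracle.ofLanguage T u := by
  rw [Oracle.ofLanguage_apply, Oracle.ofLanguage_apply, boolIndicator_eq_of_iff (mem_tabLang_table_iff hT hu)]

/-- **Reading the table with the adaptive-query generator `⟨x, answers⟩ ↦ 0^{|answers|}`**: after
`m` rounds the answer bits of `AdaptiveQueries.adBits` are the table of `T` below `m` (the
queries are `0⁰, 0¹, …, 0^{m-1}`, whatever the answers). [folklore] -/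
theorem adBits_eq_table (T : Language Bool) (x : List Bool) :
    ∀ m : ℕ, AdQuery.adBits (Kannan.zerosFn ∘ sndP) T x m = table T m
  | 0 => by simp [table]
  | m + 1 => by
    rw [AdQuery.adBits_succ, adBits_eq_table T x m, Function.comp_apply, sndP_boolPair,
      Kannan.zerosFn_apply, length_table, table_succ]

/-! ### The look-up language and the emulated verifier -/

/-- The look-up key of a coded quadruple: `lookupKeyFn ⟨⟨⟨x, t⟩, y⟩, u⟩ = t ⇂ |u|` (drop `|u|` bits of
the table). [folklore] -/
noncomputable def lookupKeyFn : List Bool → List Bool :=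
  Plumb.dropFn ∘ fanoutFn sndF (sndF ∘ fstF ∘ fstF)

/-- Value of `lookupKeyFn` on a coded quadruple. [folklore] -/
@[simp] theorem lookupKeyFn_apply (x t y u : List Bool) :
    lookupKeyFn (boolPair (boolPair (boolPair x t) y) u) = t.drop u.length := by
  simp [lookupKeyFn]

/-- `lookupKeyFn ∈ FP`. [folklore] -/
theorem lookupKeyFn_mem_FP : lookupKeyFn ∈ FP :=
  comp_mem_FP Plumb.dropFn_mem_FP
    (fanoutFn_mem_FP sndF_mem_FP (comp_mem_FP sndF_mem_FP (comp_mem_FP fstF_mem_FP fstF_mem_FP)))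

/-- **The look-up language** `lookupLang = {⟨⟨⟨x, t⟩, y⟩, u⟩ | u ∈ 0* ∧ bit |u| of t is 1}`: the table
oracle presented as ONE language of (input, query) pairs, the shape of an `FP` answer rule (a proof
device of this file). [folklore] -/
noncomputable def lookupLang : Language Bool :=
  {z | sndF z = (Kannan.zerosFn ∘ sndF) z} ⊓ (lookupKeyFn ⁻¹' PRelSigma.HeadIs true)

/-- `lookupLang ∈ P` (an equality test of two `FP` maps, and the preimage of "first symbol is `1`" under
`lookupKeyFn`). [cite: AroraBarak2009, §1.3 (closure of polynomial time under composition)] -/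
theorem lookupLang_mem_P : lookupLang ∈ Classes.P :=
  inter_mem_P (setOf_apply_eq_apply_mem_P sndF_mem_FP (comp_mem_FP Kannan.zerosFn_mem_FP sndF_mem_FP))
    (preimage_mem_P (PRelSigma.HeadIs_mem_P true) lookupKeyFn_mem_FP)

/-- Membership of a coded quadruple in `lookupLang` is membership of the query in the table language.
[folklore] -/
theorem boolPair_mem_lookupLang_iff (x t y u : List Bool) :
    boolPair (boolPair (boolPair x t) y) u ∈ lookupLang ↔ u ∈ tabLang t := by
  change (sndF (boolPair (boolPair (boolPair x t) y) u) =
      Kannan.zerosFn (sndF (boolPair (boolPair (boolPair x t) y) u)) ∧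
    (lookupKeyFn (boolPair (boolPair (boolPair x t) y) u)).head? = some true) ↔
    (u = List.replicate u.length false ∧ (t.drop u.length).head? = some true)
  rw [sndF_boolPair, Kannan.zerosFn_apply, lookupKeyFn_apply]

/-- The oracle of `lookupLang` is an `FP` answer rule. [cite: AroraBarak2009, Def. 1.13] -/
theorem ofLanguage_lookupLang_mem_FP : Oracle.ofLanguage lookupLang ∈ FP :=
  indicatorFn_mem_FP lookupLang_mem_P

/-- On the input `⟨⟨x, t⟩, y⟩` the answer rule `u ↦ [⟨input, u⟩ ∈ lookupLang]` IS the table oracle of `t`.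
[folklore] -/
theorem answerRule_eq (x t y : List Bool) :
    (fun u => Oracle.ofLanguage lookupLang (boolPair (boolPair (boolPair x t) y) u)) =
      Oracle.ofLanguage (tabLang t) := by
  funext u
  rw [Oracle.ofLanguage_apply, Oracle.ofLanguage_apply, boolIndicator_eq_of_iff (boolPair_mem_lookupLang_iff x t y u)]

/-- The input preparation `⟨⟨x, t⟩, y⟩ ↦ ⟨x, y⟩` (forget the table). [folklore] -/
noncomputable def forgetTableFn : List Bool → List Bool :=
  fanoutFn (fstF ∘ fstF) sndF

/-- Value of `forgetTableFn` on a coded triple. [folklore] -/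
@[simp] theorem forgetTableFn_apply (x t y : List Bool) : forgetTableFn (boolPair (boolPair x t) y) = boolPair x y := by
  simp [forgetTableFn]

/-- `forgetTableFn ∈ FP`. [folklore] -/
theorem forgetTableFn_mem_FP : forgetTableFn ∈ FP :=
  fanoutFn_mem_FP (comp_mem_FP fstF_mem_FP fstF_mem_FP) sndF_mem_FP

/-- **The emulated verifier** `simL M q = {⟨⟨x, t⟩, y⟩ | M with the table oracle of t accepts
⟨x, y⟩ within q rounds}`: the preimage of "first symbol is `1`" under the emulation
`OracleAlg.simFn` of `M` (outputs coded as one-symbol strings) on `⟨x, y⟩`, each query `u` answered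
by `[⟨input, u⟩ ∈ lookupLang]`, clocked and capped at `q(|input|)`. (Off genuine runs the value is junk; only
`mem_simL_iff` is used; the emulation device is Arora–Barak's Example 3.6 (2), `P^{P} = P`.)
[cite: AroraBarak2009, §3.4 Example 3.6 (2)] -/
noncomputable def simL (M : OracleAlg Bool) (q : Polynomial ℕ) : Language Bool :=
  OracleAlg.simFn (M.mapOut encodeBool) forgetTableFn (Oracle.ofLanguage lookupLang) q q ⁻¹' PRelSigma.HeadIs true

/-- **`simL M q ∈ P`** for polynomial-time `M` (`simFn ∈ FP`: `FP^{FP} ⊆ FP`).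
[cite: AroraBarak2009, §3.4 Example 3.6 (2)] -/
theorem simL_mem_P {M : OracleAlg Bool} (hM : M.IsPolyTime encodingBoolBool) (q : Polynomial ℕ) :
    simL M q ∈ Classes.P :=
  preimage_mem_P (PRelSigma.HeadIs_mem_P true)
    (OracleAlg.simFn_mem_FP (hM.mapOut encodeBool fun _ => rfl) forgetTableFn_mem_FP ofLanguage_lookupLang_mem_FP q q)

/-- **Semantics of the emulated verifier**: if `M` with the table oracle of `t` outputs `b` on
`⟨x, y⟩` within `q |⟨x, y⟩|` rounds, asking queries of length `≤ q |⟨x, y⟩|`, then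
`⟨⟨x, t⟩, y⟩ ∈ simL M q ↔ b = 1`. [cite: AroraBarak2009, §3.4 Example 3.6 (2)] -/
theorem mem_simL_iff {M : OracleAlg Bool} {q : Polynomial ℕ} {x t y : List Bool} {b : Bool}
    (hrun : M.run (Oracle.ofLanguage (tabLang t)) (q.eval (boolPair x y).length) (boolPair x y) = some b)
    (hqs : ∀ u ∈ M.queries (Oracle.ofLanguage (tabLang t)) (q.eval (boolPair x y).length) (boolPair x y),
      u.length ≤ q.eval (boolPair x y).length) :
    boolPair (boolPair x t) y ∈ simL M q ↔ b = true := by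
  have hR : q.eval (boolPair x y).length ≤ q.eval (boolPair (boolPair x t) y).length :=
    TM2Iter.eval_mono q (by simp only [length_boolPair]; omega)
  have hrun' : (M.mapOut encodeBool).run
      (fun u => Oracle.ofLanguage lookupLang (boolPair (boolPair (boolPair x t) y) u))
      (q.eval (boolPair (boolPair x t) y).length) (forgetTableFn (boolPair (boolPair x t) y)) =
        some (encodeBool b) := by
    rw [answerRule_eq, forgetTableFn_apply, OracleAlg.run, OracleAlg.runAux_mapOut, ← OracleAlg.run,
      OracleAlg.run_mono M _ _ hR hrun]
    rfl
  have hq' : ∀ u ∈ (M.mapOut encodeBool).queries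
      (fun u => Oracle.ofLanguage lookupLang (boolPair (boolPair (boolPair x t) y) u))
      (q.eval (boolPair (boolPair x t) y).length) (forgetTableFn (boolPair (boolPair x t) y)),
        u.length ≤ q.eval (boolPair (boolPair x t) y).length := by
    intro u hu
    rw [answerRule_eq, forgetTableFn_apply, OracleAlg.queries, OracleAlg.queriesAux_mapOut, ← OracleAlg.queries,
      OracleAlg.queries_eq_of_run_eq_some M _ _ hR hrun] at hu
    exact (hqs u hu).trans hR
  have hsim := OracleAlg.simFn_eq_of_run hrun' hq'
  change OracleAlg.simFn (M.mapOut encodeBool) forgetTableFn (Oracle.ofLanguage lookupLang) q q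
    (boolPair (boolPair x t) y) ∈ PRelSigma.HeadIs true ↔ b = true
  rw [hsim, PRelSigma.mem_HeadIs]
  cases b <;> simp [encodeBool]

/-! ### `NP^T ⊆ P^T` for tally `T` under `P = NP` -/

/-- **Long–Selman, main direction**: if `P = NP` then `NP^T ⊆ P^T` for every tally `T` — read
the table of `T` up to the query bound (a truth-table round of `AdaptiveQueries.adLang`), then
decide the unrelativized `NP = P` predicate "some certificate makes the table-fed verifier accept".
[cite: LongSelman1986, abstract and main theorem] [cite: Schoning1986, §6.1 Thm. 6.3 and Cor. 6.4] -/
theorem NPRel_subset_PRel_of_isTally (hP : Classes.P = Nondeterministic.NP) {T : Language Bool}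
    (hT : IsTally T) : NPRel (Oracle.ofLanguage T) ⊆ PRel (Oracle.ofLanguage T) := by
  rintro L ⟨L', hL', p, hp⟩
  obtain ⟨M, hM, q, hMq⟩ := hL'
  -- the table-fed verifier with the explicit witness-length test, and its `NP = P` projection
  set L₂ : Language Bool := simL M q ⊓ (forgetTableFn ⁻¹' LenLe p) with hL₂def
  have hL₂ : L₂ ∈ Classes.P :=
    inter_mem_P (simL_mem_P hM q) (preimage_mem_P (LenLe_mem_P p) forgetTableFn_mem_FP)
  set L₁ : Language Bool := {z | ∃ y : List Bool, y.length ≤ p.eval z.length ∧ boolPair z y ∈ L₂}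
    with hL₁def
  have hL₁NP : L₁ ∈ Nondeterministic.NP := ⟨L₂, hL₂, p, fun z => Iff.rfl⟩
  have hL₁ : L₁ ∈ Classes.P := by rw [hP]; exact hL₁NP
  -- membership in `L₂` of a coded triple
  have hmemL₂ : ∀ x t y : List Bool, boolPair (boolPair x t) y ∈ L₂ ↔
      boolPair (boolPair x t) y ∈ simL M q ∧ y.length ≤ p.eval x.length := by
    intro x t y
    change (boolPair (boolPair x t) y ∈ simL M q ∧ forgetTableFn (boolPair (boolPair x t) y) ∈ LenLe p) ↔ _
    rw [forgetTableFn_apply, boolPair_mem_LenLe]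
  -- the table length `m(|x|) = q(2|x| + 2 + p|x|) + 1` exceeds every query of `M` on `⟨x, y⟩`
  set mP : Polynomial ℕ := q.comp (2 * X + 2 + p) + 1 with hmPdef
  have hmP : ∀ x y : List Bool, y.length ≤ p.eval x.length →
      q.eval (boolPair x y).length < mP.eval x.length := by
    intro x y hy
    have h1 : q.eval (boolPair x y).length ≤ q.eval (2 * x.length + 2 + p.eval x.length) :=
      TM2Iter.eval_mono q (by simp only [length_boolPair]; omega)
    have h2 : mP.eval x.length = q.eval (2 * x.length + 2 + p.eval x.length) + 1 := by
      simp only [hmPdef, eval_add, eval_comp, eval_mul, eval_ofNat, eval_X, eval_one]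
    omega
  -- on `⟨x, y⟩` with `|y| ≤ p|x|`, the table-fed verifier accepts iff `⟨x, y⟩ ∈ L'`
  have hsim : ∀ x y : List Bool, y.length ≤ p.eval x.length →
      (boolPair (boolPair x (table T (mP.eval x.length))) y ∈ simL M q ↔ boolPair x y ∈ L') := by
    intro x y hy
    obtain ⟨hrunT, hqT⟩ := hMq (boolPair x y)
    have hagree : ∀ u ∈ M.queries (Oracle.ofLanguage T) (q.eval (boolPair x y).length) (boolPair x y),
        Oracle.ofLanguage (tabLang (table T (mP.eval x.length))) u = Oracle.ofLanguage T u :=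
      fun u hu => ofLanguage_tabLang_table hT ((hqT u hu).trans_lt (hmP x y hy))
    have hrun := (Literature.Computability.QuantumComplexity.run_congr M hagree).trans hrunT
    have hqs : ∀ u ∈ M.queries (Oracle.ofLanguage (tabLang (table T (mP.eval x.length))))
        (q.eval (boolPair x y).length) (boolPair x y), u.length ≤ q.eval (boolPair x y).length := by
      rw [Literature.Computability.QuantumComplexity.queries_congr M hagree]
      exact hqT
    rw [mem_simL_iff hrun hqs]
    exact (Set.mem_iff_boolIndicator _ _).symm
  -- `L` is the truth-table reduction: read the table, then decide `⟨x, table⟩ ∈ L₁`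
  have key : L = AdQuery.adLang (Kannan.zerosFn ∘ sndP) mP L₁ T := by
    ext x
    rw [AdQuery.mem_adLang_iff, adBits_eq_table, hp x]
    change _ ↔ ∃ y : List Bool, y.length ≤ p.eval (boolPair x (table T (mP.eval x.length))).length ∧
      boolPair (boolPair x (table T (mP.eval x.length))) y ∈ L₂
    constructor
    · rintro ⟨y, hy, hxy⟩
      refine ⟨y, hy.trans (TM2Iter.eval_mono p (by simp only [length_boolPair]; omega)), ?_⟩
      exact (hmemL₂ _ _ _).2 ⟨(hsim x y hy).2 hxy, hy⟩
    · rintro ⟨y, -, hy⟩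
      obtain ⟨hsy, hy⟩ := (hmemL₂ _ _ _).1 hy
      exact ⟨y, hy, (hsim x y hy).1 hsy⟩
  rw [key]
  exact AdQuery.adLang_mem_PRel (comp_mem_FP Kannan.zerosFn_mem_FP sndP_mem_FP) hL₁ T

end LongSelman

/-! ### The discharges -/

/-- **Long–Selman's tally theorem, the unproved direction, discharged**: if `P = NP` then
`P^T = NP^T` for every tally `T` (`P^T ⊆ NP^T` always, `PRel_subset_NPRel_holds`; `NP^T ⊆ P^T` by
`LongSelman.NPRel_subset_PRel_of_isTally`). [cite: LongSelman1986, abstract and main theorem] [cite: Schoning1986, §6.1 Cor. 6.4] [cite: HemachandraRubinstein1992, Lemma 2.3 (p. 313)] -/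
theorem longSelman1986_tally_mp_holds : longSelman1986_tally_mp :=
  fun hP _ hT => Set.Subset.antisymm (PRel_subset_NPRel_holds _) (LongSelman.NPRel_subset_PRel_of_isTally hP hT)

/-- **Long–Selman's tally theorem, discharged**: `P = NP ↔ ∀ tally T, P^T = NP^T`.
[cite: LongSelman1986, abstract and main theorem] [cite: Schoning1986, §6.1 Cor. 6.4] [cite: HemachandraRubinstein1992, Lemma 2.3 (p. 313)] -/
theorem longSelman1986_tally_holds : longSelman1986_tally :=
  longSelman1986_tally_of_mp longSelman1986_tally_mp_holds

/-- Hence, hypothesis-free: a TALLY no-go against `P = NP` would itself be a proof of `P ≠ NP`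
(`not_cRelativizes_tally_P_eq_NP_iff` with its hypothesis discharged).
[cite: LongSelman1986, abstract] [cite: Schoning1986, §6.1 Cor. 6.4 ("Thus, P ≠ NP if a tally set T can be constructed such that P(T) ≠ NP(T)")] -/
theorem tally_not_cRelativizes_P_eq_NP_iff :
    (¬ CRelativizes {T | IsTally T} fun O => PRel O = NPRel O) ↔ P ≠ NP :=
  not_cRelativizes_tally_P_eq_NP_iff longSelman1986_tally_holds

/-- The same in the summit's shape, hypothesis-free: `P = NP` is TALLY-relativizing iff the core
statement `∃ L ∈ NP, L ∉ P` fails (`cRelativizes_tally_P_eq_NP_iff_not_pneNP` discharged).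
[cite: LongSelman1986, abstract] [cite: Schoning1986, §6.1 Cor. 6.4] -/
theorem tally_cRelativizes_P_eq_NP_iff_not_pneNP :
    (CRelativizes {T | IsTally T} fun O => PRel O = NPRel O) ↔ ¬ ∃ L ∈ NP, L ∉ P :=
  cRelativizes_tally_P_eq_NP_iff_not_pneNP longSelman1986_tally_holds

end Literature.Barriers.PneNP
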